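import Literature.Analysis.FluidPDE.ContinuousAlignmentTypeI
import Literature.Analysis.FluidPDE.KNSSRemark61
import Literature.Analysis.FluidPDE.KNSSTypeIRateLiouville
import Literature.Analysis.FluidPDE.KNSSTypeIRateLiouvilleMild
import Literature.Analysis.FluidPDE.KNSSLiouvillePlanarHolds
import Literature.Analysis.FluidPDE.CurlFreeLiouville
import Literature.Analysis.FluidPDE.NSBoundedMildOseenClassical
import HarnessLib

/-!
# Giga–Miura 2011, §2.1: blow-up analysis behind the continuous-alignment criterion
# (Propositions 2.1–2.2, Lemma 2.3, Corollary 2.4, and Theorem 1.1 under (CA′))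

Topic `Analysis/FluidPDE`. Source: Y. Giga, H. Miura, *On vorticity directions near singularities
for the Navier–Stokes flows with infinite energy*, Comm. Math. Phys. **303** (2011) 289–300
[GigaMiura2011]. Numbering and page locators below are those of the SUBMITTED TEXT, Hokkaido
University Preprint Series in Mathematics **#956** (30 March 2010; the CMP version was received
7 April 2010), which we hold in full (lit key `paper:url-45d04fdad14a`; per-page render
`run/shared/lean/pub/ns-regularity-ideate/ns-regularity-ideate-lit/renders/GM11-HokkaidoPreprint956-full/`,
`page-NN.txt` = preprint page NN): §2.1 "Proof of Theorem 1.1" = pp. 5–10 (blow-up sequence p. 5,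
the bounds (2.1) p. 6, **Prop. 2.1** p. 6, **Prop. 2.2** pp. 7–8, **Lemma 2.3 / Cor. 2.4 /
Rmk. 2.5** p. 8, proof of Lemma 2.3 p. 9); Remark 1.4 = condition (CA′), p. 4. The CMP pages
289–290 we hold (Springer preview) agree verbatim with preprint pp. 1–3 up to copy-editing; the
CMP numbering of §2 is NOT independently verified (acquisition acq-10949 open) — every `[cite]`
below therefore names "§2.1" together with the preprint page.

Companion of `Literature.Analysis.FluidPDE.ContinuousAlignmentTypeI`, which vendors the paper's
**Theorem 1.1** (continuous alignment (CA) under Type I excludes blow-up) as the named fact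
`gigaMiura_continuousAlignment_typeI` in the tree's Leray–Hopf frame. This file vendors the
§2.1 machinery the three N0 routes of the NS ladder cite as their print anchors
(`Summit.NavierStokesRegularity.NavierStokesRegularity.Theses.ScaledTopAlignment`: crux
`TypeIZoomNonAlignedLimit` "← Giga–Miura 2011 Prop 2.1–2.2 … §2.1 p. 8 + Lemma 2.3 / Cor 2.4";
`….Theses.LocalSineTubeDoor`: "Giga–Miura 2011 Thm 1.1 / Rmk 1.4 (CA′)", crux
`ProfileAlignedWindowRigidity` "Giga–Miura 2D reduction ⇒ KNSS planar Liouville";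
`….Theses.ContinuousAlignment`).

## What is printed (HUPS #956, verbatim up to notation)

* p. 5–6, the blow-up sequence: assuming `lim sup_{t↑0} ‖u‖_∞ = ∞`, take `t_k ↑ 0` with
  `sup_{−1≤τ≤t_k} ‖u‖_∞(τ) = ‖u‖_∞(t_k) =: M_k ↑ ∞`, `x_k` with `|u(x_k,t_k)| ≥ M_k − 1`,
  `u_k(x,t) = λ_k u(x_k + λ_k x, t_k + λ_k² t)`, `λ_k = 1/M_k`; then `|u_k| ≤ 1` on
  `ℝ³ × (−M_k², 0]`, the parabolic bounds (2.1) `‖∂ₜʲu_k‖_∞ + ‖∇ʲu_k‖_∞ ≤ C_j` hold, and a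
  subsequence `(u_k, ω_k)` converges locally uniformly on `ℝ³ × (−∞, 0]` to bounded continuous
  `(u, ω)`, `u` a mild solution, `|u| ≤ 1`, `|ω| ≤ C`, `|u(0,0)| = 1`.
* **Proposition 2.1.** "Assume that `u` is a type I mild solution of (NS) in `ℝ³ × (−1, 0)`.
  Then `ω ≢ 0` in `ℝ³ × (−∞, 0]`." Proof (p. 6): "Suppose that `ω ≡ 0` so that `curl ω = 0`.
  Since `−Δu = curl ω` by `div u = 0`, the Liouville theorem for harmonic functions yields `u` is
  spatially constant. Moreover since `u` is a mild solution, `u` is also constant in time. Then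
  the condition `|u(0,0)| = 1` implies `‖u‖_∞(t) = 1` for all `t < 0`. From the type I
  assumption … `‖u‖_∞(t) ≤ C₀(−t)^{−1/2}`. This contradicts with the fact `‖u‖_∞(t) ≡ 1`."
* **Proposition 2.2.** "Assume that `u` is a mild solution of (NS) in `ℝ³ × (−1, 0)` which is
  bounded in `ℝ³ × (−1, −δ)` for all `δ > 0`. If `ζ` satisfies (CA′), then `ω = 0`." — `ω` being
  the vorticity of the blow-up limit above; "These two propositions imply the main theorem
  (Theorem 1.1)." Its proof (pp. 7–8) first kills the modulus along the zoom ("`|ζ(x,t) − ζ(y,t)|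
  = 0` for `x, y ∈ K` … we have `ω(x,t) = |ω(x,t)| ζ₀(t)` where `ζ₀(t)` is a vector in `ℝ³`
  depending only on `t`"), then shows such a limit has `ω ≡ 0`: "`−Δu₃ = (curl ω)₃ = 0` in `ℝ³`
  … `u₃` is spatially constant … `u₁` and `u₂` are independent of `x₃`. Thus the flow is
  two-dimensional at `t = t₀` … by the unique local existence theorem of mild solution in [GIM],
  the solution stays two-dimensional … `ζ₀` is independent of `t` … solves the two-dimensional
  vorticity equation (2.2). However, the following lemma … implies that `ω ≡ 0`".
* **Lemma 2.3.** "Assume that `u = (u₁, u₂)` and `ω₃` are bounded smooth solution of (2.2)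
  [`ω₃ₜ − Δω₃ + (u, ∇)ω₃ = 0` in `ℝ² × (−∞, 0)`]. Assume that `curl u = ω` and `div u = 0`. Then
  `ω ≡ 0`."
* **Corollary 2.4.** "Assume that `u` is a bounded backward global mild smooth solutions of (NS)
  in `ℝ² × (−∞, 0)`. Then `u` must be a constant in space time." **Remark 2.5 (ii)**: "Corollary
  2.4 is already proved in [KNSS] by using stability of the strong maximum principle."
* **Remark 1.4** (p. 4), condition (CA′): "`|ζ(x,t) − ζ(y,t)| ≤ η(o(1)|x − y|/√(−t))` for
  `x, y ∈ Ω_d(t)` and `t ∈ (−1, 0)` as `t ↑ 0`. We will prove the theorem under the condition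
  (CA′) in Section 2.1."

## What this file declares

* `gigaMiura2011_curl_not_identically_zero_of_typeI` — **Proposition 2.1**, PROVED, for the
  class of Giga–Miura's blow-up limits in the tree's (KNSS) rendering of bounded ancient mild
  solutions by the pointwise Oseen integral equation (`UnboundedOperators.heatExtension`,
  `oseenDuhamel`; the hypothesis list of `KNSS2009_typeI_rate_liouville`): a bounded, jointly
  continuous, weakly divergence-free, Oseen-mild ancient field on `ℝ³` with `C²` slices, not
  identically zero and with the Type I time decay `√(−t)‖v(t,x)‖ ≤ C₀`, does NOT have identically
  vanishing curl. The printed proof is followed line by line: curl-free + divergence-free +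
  bounded slices are constant (`eq_of_curl_eq_zero_of_isDivFree_of_bounded`, the harmonic
  Liouville step), mild ⇒ constant in time (`KNSS2009_remark61`), Type I decay as `t → −∞` ⇒ the
  constant is `0` (`eq_zero_of_forall_sqrt_neg_mul_norm_le`).
* `gigaMiura2011_planar_ancient_mild_const` — **Corollary 2.4**, PROVED from KNSS 2009 Thm 5.1
  (`KNSS2009_liouville_planar_holds`, a tree theorem) and Remark 6.1 (`KNSS2009_remark61`),
  exactly as Remark 2.5 (ii) says, in the same Oseen rendering on `ℝ²` (continuity replaces
  "smooth": a weaker hypothesis, so the theorem covers the printed one).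
* `gigaMiura2011_planar_vorticity_liouville` — **Lemma 2.3** as printed, a NAMED FACT (its
  printed proof — time shift, translation compactness "[GIM] or [GGS]", strong maximum principle,
  harmonic Liouville — needs interior parabolic estimates for (2.2) with a bounded smooth drift
  that the tree does not have in this generality; the tree's `curl2_eq_zero_of_lemma21` +
  `KNSS2009_lemma21_halfball_holds` prove it in the sub-class with all space derivatives bounded
  and time-Lipschitz, `KNSSLiouvillePlanar`).
* `gigaMiura2011_unidirectional_vorticity_eq_zero` — the CORE of **Proposition 2.2** (the
  argument of pp. 7–8 after the modulus is killed), a NAMED FACT: an Oseen-mild bounded ancient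
  field on `ℝ³` with the bounds (2.1), whose vorticity is `ω(t,x) = |ω(t,x)| ζ₀(t)` with a
  direction depending on time only, has `ω ≡ 0`.
* `gigaMiura2011_scaledAlignment_blowupLimit_curl_eq_zero` — **Proposition 2.2** as printed
  (blow-up-limit form under (CA′)), a NAMED FACT, transcribed to the tree's Leray–Hopf frame
  exactly as `gigaMiura_continuousAlignment_typeI` transcribes Theorem 1.1 (module docstring of
  `ContinuousAlignmentTypeI`): viscosity `ν`, times `(0, T)`, blow-up at `T`, the near-maximum
  parabolic zoom with `λ_k = ν/M_k`, and ANY pointwise limit of the rescaled vorticities.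
* `gigaMiura2011_scaledAlignment_typeI` — **Theorem 1.1 under (CA′)** (Remark 1.4), a NAMED
  FACT in the frame of `gigaMiura_continuousAlignment_typeI`, and the PROVED reduction
  `gigaMiura_continuousAlignment_typeI_of_scaledAlignment` ((CA) is (CA′) with
  `o(1) = √(ν(T − t))`), so that the older fact is subsumed.

## Rendering choices

* **Bounded backward-global mild solutions** are rendered, as everywhere in the tree's KNSS
  files (`KNSS2009_typeI_rate_liouville`, `KNSS2009_lemma61_oseenMild`, `KNSS2009_remark61`), by
  the pointwise Oseen integral equation `v(t) = e^{(t−s)Δ} v(s) − B¹_s(v,v)(t)` for all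
  `s < t < 0`, joint continuity on `(−∞, 0) × ℝⁿ`, a uniform bound, and weakly divergence-free
  slices; `ν = 1` as printed. Giga–Miura's "mild" (p. 3: "solution satisfying an integral
  equation, which is equivalent to require that `p = (−Δ)⁻¹∇·(u ⊗ u)`") is this class; their
  limits are smooth with the bounds (2.1), which we keep as explicit hypotheses where the printed
  argument uses them (they are consequences of boundedness in this class, KNSS 2009 §4, but that
  is not used here).
* The limit is taken on the OPEN time half-line `(−∞, 0)`; the printed normalisation
  `|u(0,0)| = 1` at the closed end is replaced, in Proposition 2.1, by the weaker "not identically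
  zero on `(−∞, 0) × ℝ³`" (which it implies by continuity), so the proved statement is stronger.
* (CA′) in the forward frame with viscosity `ν` and blow-up time `T`: a modulus `η`
  (non-decreasing and continuous on `[0, ∞)`, `η 0 = 0`), a level `d > 0` and a non-negative
  function `θ` with `θ(t) → 0` as `t ↑ T` (the printed `o(1)`) such that
  `‖ξ(t,x) − ξ(t,y)‖ ≤ η(θ(t)‖x − y‖/√(ν(T − t)))` whenever `|ω(t,x)|, |ω(t,y)| > d`.

## What is NOT here

The compactness step (2.1) ⇒ locally uniform convergence of `(u_k, ω_k)` as a statement (KNSS's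
form is the tree theorem `KNSS2009_lemma61_oseenMild`, `AncientMildCompactness`); §2.2 (Def. 2.9,
the local Theorem 2.10) and §3 (boundary effects) — other sections, other files.

## References

* Y. Giga, H. Miura, Comm. Math. Phys. 303 (2011) 289–300 = Hokkaido Univ. Preprint #956 (2010):
  §1 Thm 1.1, Rmks 1.2–1.4 (pp. 3–4); §2.1 (pp. 5–10). [GigaMiura2011]
* G. Koch, N. Nadirashvili, G. Seregin, V. Šverák, Acta Math. 203 (2009) 83–105: Thm 5.1,
  Remark 6.1, Lemma 6.1, Prop 6.1. [KochNadirashviliSereginSverak2009]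
* Y. Giga, K. Inui, S. Matsui, Quad. Mat. 4 (1999) 27–68 (= [GIM]: local existence and
  uniqueness of bounded mild solutions). [GigaInuiMatsui1999]
-/

noncomputable section

open MeasureTheory Set Function Filter
open _root_.Topology
open scoped Laplacian

namespace Literature.Analysis.FluidPDE

/-! ### Proposition 2.1: under Type I the blow-up limit has non-trivial vorticity (proved) -/

/-- **Giga–Miura 2011, Proposition 2.1** (HUPS #956 p. 6 = CMP 303 §2.1: "Assume that `u` is a
type I mild solution of (NS) in `ℝ³ × (−1, 0)`. Then `ω ≢ 0` in `ℝ³ × (−∞, 0]`", `ω` the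
vorticity of the blow-up limit `(u, ω)` of §2.1), proved for the CLASS of such limits in the
tree's Oseen rendering (module docstring): let `v : ℝ → ℝ³ → ℝ³` be jointly continuous on
`(−∞, 0) × ℝ³`, bounded, with `C²` weakly divergence-free slices, satisfy the Oseen integral
equation `v(t) = e^{(t−s)Δ}v(s) − B¹_s(v,v)(t)` for all `s < t < 0`, be not identically zero, and
have the Type I decay `√(−t)‖v(t,x)‖ ≤ C₀` inherited from the type I assumption (p. 6:
"`‖u_k‖_∞(t) ≤ C₀(M_k²|t_k| + |t|)^{−1/2} ≤ C₀(−t)^{−1/2}`, which yields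
`‖u‖_∞(t) ≤ C₀(−t)^{−1/2}`"). Then `curl v` is not identically zero on `(−∞, 0) × ℝ³`. Proof as
printed: if `curl v ≡ 0`, each slice is bounded, curl- and divergence-free, hence constant
(harmonic Liouville, `eq_of_curl_eq_zero_of_isDivFree_of_bounded`); a mild solution of the form
`b(t)` is constant in time (`KNSS2009_remark61`); the decay as `t → −∞` forces the constant to
vanish, contradicting non-triviality. [cite: GigaMiura2011, Prop. 2.1 and its proof (§2.1; HUPS preprint #956 p. 6)] -/
theorem gigaMiura2011_curl_not_identically_zero_of_typeI {C₀ : ℝ} {v : ℝ → EuclideanSpace ℝ (Fin 3) → EuclideanSpace ℝ (Fin 3)}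
    (hC2 : ∀ t < 0, ContDiff ℝ 2 (v t))
    (hbdd : ∃ K : ℝ, ∀ t < 0, ∀ x, ‖v t x‖ ≤ K)
    (hdiv : ∀ t < 0, IsWeaklyDivFree (v t))
    (hmild : ∀ s t : ℝ, s < t → t < 0 → ∀ x,
      v t x = UnboundedOperators.heatExtension (v s) (t - s) x - oseenDuhamel 1 s v v t x)
    (hnt : ∃ t < 0, ∃ x, v t x ≠ 0)
    (hI : ∀ t < 0, ∀ x, Real.sqrt (-t) * ‖v t x‖ ≤ C₀) :
    ¬ ∀ t < 0, ∀ x, curl (v t) x = 0 := by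
  intro hcurl
  obtain ⟨K, hK⟩ := hbdd
  -- Step 1 (harmonic Liouville): every slice is spatially constant
  have hconst : ∀ t < 0, ∀ x, v t x = v t 0 := fun t ht x =>
    eq_of_curl_eq_zero_of_isDivFree_of_bounded (hC2 t ht) (hcurl t ht)
      ((hdiv t ht).isDivFree_of_contDiff ((hC2 t ht).of_le (by norm_num))) (hK t ht) x 0
  -- Step 2 (mild ⇒ constant in time): KNSS Remark 6.1
  have htime : ∀ s t : ℝ, s < 0 → t < 0 → v s 0 = v t 0 := by
    refine KNSS2009_remark61 (ν := (1 : ℝ)) one_pos (b := fun t => v t 0) hconst ?_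
    intro s t hst ht
    refine Eventually.of_forall fun x => ?_
    rw [one_mul]
    exact hmild s t hst ht x
  -- Step 3 (Type I decay as `t → −∞`): the constant vanishes
  obtain ⟨t₀, ht₀, x₀, hx₀⟩ := hnt
  have hzero : v t₀ 0 = 0 := by
    refine eq_zero_of_forall_sqrt_neg_mul_norm_le (t := t₀) (C := C₀) (fun s hs => ?_) ht₀.le
    have hs0 : s < 0 := hs.trans ht₀
    rw [← htime s t₀ hs0 ht₀, ← hconst s hs0 x₀]
    exact hI s hs0 x₀
  exact hx₀ (by rw [hconst t₀ ht₀ x₀, hzero])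

/-! ### Corollary 2.4: planar bounded ancient mild solutions are constant (proved, via KNSS) -/

/-- **Giga–Miura 2011, Corollary 2.4** (HUPS #956 p. 8 = CMP 303 §2.1: "Assume that `u` is a
bounded backward global mild smooth solutions of (NS) in `ℝ² × (−∞, 0)`. Then `u` must be a
constant in space time"; Remark 2.5 (ii): "Corollary 2.4 is already proved in [KNSS] by using
stability of the strong maximum principle"), PROVED exactly along Remark 2.5 (ii), in the Oseen
rendering of bounded backward-global mild solutions (module docstring; continuity instead of
smoothness): for `w : ℝ → ℝ² → ℝ²` jointly continuous on `(−∞, 0) × ℝ²`, bounded, with weakly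
divergence-free slices and `w(t) = e^{(t−s)Δ}w(s) − B¹_s(w,w)(t)` for all `s < t < 0`, there is
`c` with `w(t,x) = c` for all `t < 0`, `x`. Proof: such a `w` is a bounded weak solution on
`ℝ² × (−∞, 0)` (`isBoundedWeakNSSolutionOn_of_oseen`), hence `w(t,·) = b(t)` a.e. for a.e. `t`
by KNSS 2009 Thm 5.1 (`KNSS2009_liouville_planar_holds`); joint continuity upgrades this to every
`(t, x)` (`Measure.eqOn_open_of_ae_eq` twice), and Remark 6.1 (`KNSS2009_remark61`) makes `b`
constant. [cite: GigaMiura2011, Cor. 2.4 and Remark 2.5 (ii) (§2.1; HUPS preprint #956 p. 8)] -/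
theorem gigaMiura2011_planar_ancient_mild_const {w : ℝ → EuclideanSpace ℝ (Fin 2) → EuclideanSpace ℝ (Fin 2)}
    (hcont : ContinuousOn (uncurry w) (Iio 0 ×ˢ univ))
    (hbdd : ∃ K : ℝ, ∀ t < 0, ∀ x, ‖w t x‖ ≤ K)
    (hdiv : ∀ t < 0, IsWeaklyDivFree (w t))
    (hmild : ∀ s t : ℝ, s < t → t < 0 → ∀ x,
      w t x = UnboundedOperators.heatExtension (w s) (t - s) x - oseenDuhamel 1 s w w t x) :
    ∃ c : EuclideanSpace ℝ (Fin 2), ∀ t < 0, ∀ x, w t x = c := by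
  -- the slices are continuous, the time traces are continuous on `(−∞, 0)`
  have hwc : ∀ t < 0, Continuous (w t) := fun t ht =>
    hcont.comp_continuous (f := fun x : EuclideanSpace ℝ (Fin 2) => (t, x)) (by fun_prop) fun x => ⟨ht, mem_univ _⟩
  have htr : ∀ x : EuclideanSpace ℝ (Fin 2), ContinuousOn (fun t => w t x) (Iio 0) := fun x =>
    hcont.comp (f := fun t : ℝ => (t, x)) (by fun_prop) fun t ht => ⟨ht, mem_univ _⟩
  -- KNSS Theorem 5.1 for the bounded weak solution `w`
  have hweak : IsBoundedWeakNSSolutionOn (Iio 0) isOpen_Iio 1 w :=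
    isBoundedWeakNSSolutionOn_of_oseen one_pos hcont hbdd hdiv fun s t hst ht x => by
      rw [one_mul]; exact hmild s t hst ht x
  obtain ⟨b, -, -, hae⟩ := KNSS2009_liouville_planar_holds hweak
  -- a.e. slice is constant everywhere (continuity in `x`)
  have hae' : ∀ᵐ t ∂(volume.restrict (Iio (0 : ℝ))), ∀ x, w t x = w t 0 := by
    filter_upwards [hae, ae_restrict_mem measurableSet_Iio] with t ht ht0 x
    have h := Measure.eq_of_ae_eq ht (hwc t ht0) continuous_const
    rw [congrFun h x, congrFun h 0]
  -- every slice is constant (continuity in `t`)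
  have hconst : ∀ t < 0, ∀ x, w t x = w t 0 := by
    intro t ht x
    have hx : ∀ᵐ τ ∂(volume.restrict (Iio (0 : ℝ))), (fun τ => w τ x) τ = (fun τ => w τ 0) τ := by
      filter_upwards [hae'] with τ hτ using hτ x
    exact Measure.eqOn_open_of_ae_eq hx isOpen_Iio (htr x) (htr 0) ht
  -- Remark 6.1: constant in time
  have htime : ∀ s t : ℝ, s < 0 → t < 0 → w s 0 = w t 0 := by
    refine KNSS2009_remark61 (ν := (1 : ℝ)) one_pos (b := fun t => w t 0) hconst ?_
    intro s t hst ht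
    refine Eventually.of_forall fun x => ?_
    rw [one_mul]
    exact hmild s t hst ht x
  refine ⟨w (-1) 0, fun t ht x => ?_⟩
  rw [hconst t ht x, htime t (-1) ht (by norm_num)]

/-! ### Lemma 2.3: the planar vorticity Liouville theorem (named fact) -/

/-- **Giga–Miura 2011, Lemma 2.3** (HUPS #956 p. 8 = CMP 303 §2.1, verbatim: "Assume that
`u = (u₁, u₂)` and `ω₃` are bounded smooth solution of (2.2) [`ω₃ₜ − Δω₃ + (u, ∇)ω₃ = 0` in
`ℝ² × (−∞, 0)`]. Assume that `curl u = ω` and `div u = 0`. Then `ω ≡ 0`."). Rendering: time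
first; `u : ℝ → ℝ² → ℝ²` and `ω : ℝ → ℝ² → ℝ` jointly smooth on the open slab `(−∞, 0) × ℝ²`
(`ContDiffOn ℝ ∞` of the uncurried maps) and bounded there; (2.2) holds pointwise at every
`t < 0`, `x`, with `∂ₜω(t,x) = deriv (fun τ => ω τ x) t`, Mathlib's Laplacian `Δ (ω t) x` and the
drift term `D(ω t)(x)[u t x]`; `curl u = ω` is `curl2 (u t) = ω t` (the tree's planar scalar curl
`∂₀u₁ − ∂₁u₀`, `KNSSRegularityPlanar`) and `div u = 0` is `VectorCalculus.IsDivFree (u t)`.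
Printed proof (p. 9): shift time by `ε`, take `(x_k, t_k)` with `ω^ε(x_k,t_k) → L = sup|ω^ε|`,
pass to a translation limit ("`L^∞` theory of the Navier–Stokes equations [GIM] or the vorticity
equations [GGS]"), strong maximum principle `⇒ ω̃^ε ≡ L`, then "`−Δũ = curl ω̃`, the Liouville
theorem for harmonic functions yields `ũ` is spatially constant which implies `ω̃ = 0`",
contradiction. The tree proves the statement in the sub-class with all space derivatives of `u`
bounded and time-Lipschitz (`curl2_eq_zero_of_lemma21` with `KNSS2009_lemma21_halfball_holds`,
KNSS 2009 Thm 5.1's proof); the printed generality needs interior parabolic estimates for (2.2)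
not yet in the tree, so nothing is asserted; users take
`(h : gigaMiura2011_planar_vorticity_liouville)`. [cite: GigaMiura2011, Lemma 2.3 (§2.1; HUPS preprint #956 p. 8, proof p. 9)] -/
def gigaMiura2011_planar_vorticity_liouville : Prop :=
  ∀ ⦃u : ℝ → EuclideanSpace ℝ (Fin 2) → EuclideanSpace ℝ (Fin 2)⦄ ⦃ω : ℝ → EuclideanSpace ℝ (Fin 2) → ℝ⦄,
    ContDiffOn ℝ (⊤ : ℕ∞) (uncurry u) (Iio 0 ×ˢ univ) →
    ContDiffOn ℝ (⊤ : ℕ∞) (uncurry ω) (Iio 0 ×ˢ univ) →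
    (∃ K : ℝ, ∀ t < 0, ∀ x, ‖u t x‖ ≤ K ∧ |ω t x| ≤ K) →
    -- (2.2): `ω₃ₜ − Δω₃ + (u, ∇)ω₃ = 0` in `ℝ² × (−∞, 0)`
    (∀ t < 0, ∀ x, deriv (fun τ => ω τ x) t - (Δ (ω t)) x + fderiv ℝ (ω t) x (u t x) = 0) →
    -- `curl u = ω` and `div u = 0`
    (∀ t < 0, curl2 (u t) = ω t) → (∀ t < 0, VectorCalculus.IsDivFree (u t)) →
    ∀ t < 0, ∀ x, ω t x = 0

/-! ### Proposition 2.2, core: a time-only vorticity direction forces `ω ≡ 0` (named fact) -/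

/-- **Giga–Miura 2011, Proposition 2.2 — the rigidity argument of its proof** (HUPS #956
pp. 7–8 = CMP 303 §2.1). After (CA′) is used along the blow-up sequence the limit satisfies
"`ω(x,t) = |ω(x,t)| ζ₀(t)`, where `ζ₀(t)` is a vector in `ℝ³` depending only on `t`", and the
printed argument concludes `ω ≡ 0`: "By rotation we may assume that `ω(x,t₀) = (0, 0, ω₃(x,t₀))`
… At `t = t₀` since `(curl ω)₃ = 0` we have `−Δu₃ = (curl ω)₃ = 0` in `ℝ³`. By the Liouville
theorem for harmonic functions this implies that `u₃` is spatially constant. Since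
`0 = ω₁ = ∂u₃/∂x₂ − ∂u₂/∂x₃`, `0 = ω₂ = ∂u₁/∂x₃ − ∂u₃/∂x₁`, we observe that `u₁` and `u₂` are
independent of `x₃`. Thus the flow is two-dimensional at `t = t₀`. Once the flow is
`x₃`-independent and `u₃` is constant, by the unique local existence theorem of mild solution in
[GIM], the solution stays two-dimensional (independent of `x₃`) for `t ≥ t₀`. One may take `t₀`
arbitary so we conclude that `ζ₀` is independent of `t`. We thus conclude that `u = (u₁,u₂,0)` and
`ω = (0,0,ω₃)` solves the two-dimensional vorticity equation … the following lemma [Lemma 2.3]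
… implies that `ω ≡ 0`". **Statement (the class of Giga–Miura's blow-up limits, Oseen
rendering, module docstring).** Let `v : ℝ → ℝ³ → ℝ³` be jointly smooth on `(−∞, 0) × ℝ³` with
every space derivative bounded uniformly in `t < 0` (the bounds (2.1) passed to the limit),
weakly divergence-free slices, the Oseen integral equation `v(t) = e^{(t−s)Δ}v(s) − B¹_s(v,v)(t)`
for all `s < t < 0` (`ν = 1`), and suppose there is `ζ₀ : ℝ → ℝ³` with
`curl v(t)(x) = ‖curl v(t)(x)‖ • ζ₀(t)` for all `t < 0`, `x` (the direction of the vorticity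
depends on time only; signed, as printed). Then `curl v ≡ 0` on `(−∞, 0) × ℝ³`. No Type I decay
is assumed (Prop. 2.2 assumes only boundedness before the blow-up time); the conclusion is
`ω ≡ 0`, not `v ≡ 0` (constants survive). The two-dimensional Liouville step is the tree
theorem `gigaMiura2011_planar_ancient_mild_const` / KNSS Thm 5.1; the uniqueness step "[GIM]" is
the tree theorem `oseenMild_bounded_unique`; the slice computation and the time-independence of
the axis are not yet assembled, so nothing is asserted; users take
`(h : gigaMiura2011_unidirectional_vorticity_eq_zero)`. [cite: GigaMiura2011, Prop. 2.2, proof (§2.1; HUPS preprint #956 pp. 7–8)] -/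
def gigaMiura2011_unidirectional_vorticity_eq_zero : Prop :=
  ∀ ⦃v : ℝ → EuclideanSpace ℝ (Fin 3) → EuclideanSpace ℝ (Fin 3)⦄,
    ContDiffOn ℝ (⊤ : ℕ∞) (uncurry v) (Iio 0 ×ˢ univ) →
    (∀ k : ℕ, ∃ C : ℝ, ∀ t < 0, ∀ x, ‖iteratedFDeriv ℝ k (v t) x‖ ≤ C) →
    (∀ t < 0, IsWeaklyDivFree (v t)) →
    (∀ s t : ℝ, s < t → t < 0 → ∀ x,
      v t x = UnboundedOperators.heatExtension (v s) (t - s) x - oseenDuhamel 1 s v v t x) →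
    (∃ ζ₀ : ℝ → EuclideanSpace ℝ (Fin 3), ∀ t < 0, ∀ x, curl (v t) x = ‖curl (v t) x‖ • ζ₀ t) →
    ∀ t < 0, ∀ x, curl (v t) x = 0

/-! ### Proposition 2.2 as printed: the (CA′) blow-up limit has zero vorticity (named fact) -/

/-- **The (CA′) hypothesis of Giga–Miura 2011, Remark 1.4** (HUPS #956 p. 4 = CMP 303 §1:
"`|ζ(x,t) − ζ(y,t)| ≤ η(o(1)|x − y|/√(−t))` for `x, y ∈ Ω_d(t)` and `t ∈ (−1, 0)` as `t ↑ 0`",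
`Ω_d(t) = {x : |ω(x,t)| > d}`, `ζ = ω/|ω|`, `η` a modulus — Remark 1.2: "a nondecreasing
continuous function defined in `[0, ∞)` with `η(0) = 0`"), transcribed to the forward frame of
`gigaMiura_continuousAlignment_typeI` (viscosity `ν`, times `(0, T)`, candidate blow-up time `T`,
`ω = curl (u t)`, `ξ = vorticityDirection ω`): there are `d > 0`, a modulus `η`, and a
non-negative `θ` with `θ(t) → 0` as `t ↑ T` (the printed `o(1)`) such that
`‖ξ(t,x) − ξ(t,y)‖ ≤ η(θ(t) ‖x − y‖ / √(ν(T − t)))` for all `t ∈ (0, T)` and all `x, y` with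
`|ω(t,x)| > d`, `|ω(t,y)| > d`. (CA) is the case `θ(t) = √(ν(T − t))`
(`hasScaledContinuousAlignment_of_continuousAlignment`). [cite: GigaMiura2011, Remark 1.4, condition (CA′) (§1; HUPS preprint #956 p. 4)] -/
def HasScaledContinuousAlignment (ν T : ℝ) (u : ℝ → EuclideanSpace ℝ (Fin 3) → EuclideanSpace ℝ (Fin 3)) : Prop :=
  ∃ d : ℝ, 0 < d ∧ ∃ η θ : ℝ → ℝ, MonotoneOn η (Ici 0) ∧ ContinuousOn η (Ici 0) ∧ η 0 = 0 ∧
    (∀ t, 0 ≤ θ t) ∧ Tendsto θ (𝓝[<] T) (𝓝 0) ∧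
    ∀ t ∈ Ioo 0 T, ∀ x y : EuclideanSpace ℝ (Fin 3), d < ‖curl (u t) x‖ → d < ‖curl (u t) y‖ →
      ‖vorticityDirection (curl (u t)) x - vorticityDirection (curl (u t)) y‖ ≤
        η (θ t * ‖x - y‖ / Real.sqrt (ν * (T - t)))

/-- **(CA) implies (CA′)** (Giga–Miura 2011, Remark 1.4: "The continuous alignment assumption
(CA) can be relaxed as follows [(CA′)]"): the continuous-alignment hypothesis of
`gigaMiura_continuousAlignment_typeI` (fixed modulus `η(‖x − y‖)` on `{|ω| > d}`) is (CA′) with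
`θ(t) = √(ν(T − t))`, which is non-negative and tends to `0` as `t ↑ T`. [cite: GigaMiura2011, Remark 1.4 (§1; HUPS preprint #956 p. 4)] -/
theorem hasScaledContinuousAlignment_of_continuousAlignment {ν T : ℝ} (hν : 0 < ν)
    {u : ℝ → EuclideanSpace ℝ (Fin 3) → EuclideanSpace ℝ (Fin 3)}
    (hCA : ∃ d : ℝ, 0 < d ∧ ∃ η : ℝ → ℝ, MonotoneOn η (Ici 0) ∧ ContinuousOn η (Ici 0) ∧ η 0 = 0 ∧
      ∀ t ∈ Ioo 0 T, ∀ x y : EuclideanSpace ℝ (Fin 3), d < ‖curl (u t) x‖ → d < ‖curl (u t) y‖ →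
        ‖vorticityDirection (curl (u t)) x - vorticityDirection (curl (u t)) y‖ ≤ η ‖x - y‖) :
    HasScaledContinuousAlignment ν T u := by
  obtain ⟨d, hd, η, hmono, hηc, hη0, hCA⟩ := hCA
  refine ⟨d, hd, η, fun t => Real.sqrt (ν * (T - t)), hmono, hηc, hη0,
    fun t => Real.sqrt_nonneg _, ?_, fun t ht x y hx hy => ?_⟩
  · -- `√(ν(T − t)) → 0` as `t ↑ T`
    have h1 : Tendsto (fun t : ℝ => ν * (T - t)) (𝓝[<] T) (𝓝 0) := by
      have : Tendsto (fun t : ℝ => ν * (T - t)) (𝓝 T) (𝓝 (ν * (T - T))) :=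
        ((continuous_const.mul (continuous_const.sub continuous_id)).tendsto T)
      rw [sub_self, mul_zero] at this
      exact this.mono_left nhdsWithin_le_nhds
    have h2 := (Real.continuous_sqrt.tendsto 0).comp h1
    rwa [Real.sqrt_zero] at h2
  · have hpos : 0 < Real.sqrt (ν * (T - t)) := Real.sqrt_pos.2 (mul_pos hν (by linarith [ht.2]))
    rw [mul_div_cancel_left₀ _ hpos.ne']
    exact hCA t ht x y hx hy

/-- **Giga–Miura 2011, Proposition 2.2, as printed** (HUPS #956 p. 7 = CMP 303 §2.1: "Assume
that `u` is a mild solution of (NS) in `ℝ³ × (−1, 0)` which is bounded in `ℝ³ × (−1, −δ)` for all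
`δ > 0`. If `ζ` satisfies (CA′), then `ω = 0`." — `ω` the vorticity of the blow-up limit of the
near-maximum rescaling of p. 5, under the standing assumption `lim sup_{t↑0} ‖u‖_∞ = ∞`).
Transcribed to the Leray–Hopf frame of `gigaMiura_continuousAlignment_typeI` (classical solution
of viscosity `ν` on `ℝ³ × [0, T)`, Leray–Hopf on `[0, T)` — finite energy singles out the mild
solution of the printed class —, bounded on `ℝ³ × [0, T']` for every `T' < T`), with (CA′) as
`HasScaledContinuousAlignment ν T u`, and with the printed blow-up sequence written out: times
`t_k ∈ (0, T)`, `t_k → T`, levels `M_k → ∞` bounding `|u|` on `[0, t_k] × ℝ³` (p. 5: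
`M_k = sup_{τ ≤ t_k} ‖u‖_∞(τ)`), near-maximum centres `x_k` with `|u(t_k, x_k)| ≥ M_k − 1`, scales
`λ_k = ν/M_k` (p. 5: `λ_k = 1/M_k` at `ν = 1`), rescaled vorticities
`ω_k(s, y) = (λ_k²/ν) ω(t_k + λ_k² s/ν, x_k + λ_k y)`. CONCLUSION: every pointwise limit `Ω` of
`(ω_k)` on `(−∞, 0] × ℝ³` vanishes identically (the printed `ω = 0` for the locally uniform limit
along a subsequence; any pointwise limit along the whole sequence is such a subsequential limit, a
further extraction by (2.1) changing nothing). No Type I hypothesis (as printed). Nothing is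
asserted; users take `(h : gigaMiura2011_scaledAlignment_blowupLimit_curl_eq_zero)`.
[cite: GigaMiura2011, Prop. 2.2 (§2.1; HUPS preprint #956 p. 7, blow-up sequence p. 5)] -/
def gigaMiura2011_scaledAlignment_blowupLimit_curl_eq_zero : Prop :=
  ∀ ⦃ν T : ℝ⦄, 0 < ν → 0 < T → ∀ ⦃u : ℝ → EuclideanSpace ℝ (Fin 3) → EuclideanSpace ℝ (Fin 3)⦄ ⦃p : ℝ → EuclideanSpace ℝ (Fin 3) → ℝ⦄,
    IsClassicalNSSolutionOn (Ico 0 T) ν 0 u p → IsLerayHopfOn T ν 0 (u 0) u →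
    (∀ T' < T, ∃ M : ℝ, ∀ t ∈ Icc 0 T', ∀ x, ‖u t x‖ ≤ M) →
    HasScaledContinuousAlignment ν T u →
    -- the near-maximum blow-up sequence of p. 5
    ∀ (tk : ℕ → ℝ) (xk : ℕ → EuclideanSpace ℝ (Fin 3)) (M : ℕ → ℝ),
      (∀ k, tk k ∈ Ioo 0 T) → Tendsto tk atTop (𝓝 T) →
      (∀ k, 0 < M k) → Tendsto M atTop atTop →
      (∀ k, ∀ τ ∈ Icc 0 (tk k), ∀ x, ‖u τ x‖ ≤ M k) →
      (∀ k, M k - 1 ≤ ‖u (tk k) (xk k)‖) →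
    -- every pointwise limit of the rescaled vorticities on `(−∞, 0] × ℝ³` vanishes
    ∀ Ω : ℝ → EuclideanSpace ℝ (Fin 3) → EuclideanSpace ℝ (Fin 3),
      (∀ s ≤ 0, ∀ y, Tendsto
        (fun k => ((ν / M k) ^ 2 / ν) • curl (u (tk k + (ν / M k) ^ 2 * s / ν)) (xk k + (ν / M k) • y))
        atTop (𝓝 (Ω s y))) →
      ∀ s ≤ 0, ∀ y, Ω s y = 0

/-! ### Theorem 1.1 under (CA′) (Remark 1.4), and the reduction of (CA) to it -/

/-- **Giga–Miura 2011, Theorem 1.1 under the relaxed hypothesis (CA′)** (Remark 1.4, HUPS #956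
p. 4 = CMP 303 §1: "The continuous alignment assumption (CA) can be relaxed as follows [(CA′)] as
`t ↑ 0`. We will prove the theorem under the condition (CA′) in Section 2.1"; Theorem 1.1, p. 3:
"Let `u` be a type I mild solution of (NS) for `ℝ³ × (−1, 0)` … Then `u` does not blow up at
`t = 0`"; §2.1 p. 7: "These two propositions [2.1, 2.2] imply the main theorem"). Same frame and
transcription as `gigaMiura_continuousAlignment_typeI` (module docstring of
`ContinuousAlignmentTypeI`: classical solution of viscosity `ν` on `ℝ³ × [0, T)`, Leray–Hopf on
`[0, T)`, bounded on `ℝ³ × [0, T']` for all `T' < T`, Type I at `T`; conclusion recorded as smooth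
continuation past `T`), with (CA) replaced by (CA′) = `HasScaledContinuousAlignment ν T u`.
Nothing is asserted; users take `(h : gigaMiura2011_scaledAlignment_typeI)`; the (CA) fact follows
from it (`gigaMiura_continuousAlignment_typeI_of_scaledAlignment`). [cite: GigaMiura2011, Thm 1.1 with Remark 1.4 (CA′) (§1, HUPS preprint #956 pp. 3–4; proof §2.1 pp. 5–9)] -/
def gigaMiura2011_scaledAlignment_typeI : Prop :=
  ∀ ⦃ν T : ℝ⦄, 0 < ν → 0 < T → ∀ ⦃u : ℝ → EuclideanSpace ℝ (Fin 3) → EuclideanSpace ℝ (Fin 3)⦄ ⦃p : ℝ → EuclideanSpace ℝ (Fin 3) → ℝ⦄,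
    IsClassicalNSSolutionOn (Ico 0 T) ν 0 u p → IsLerayHopfOn T ν 0 (u 0) u →
    (∀ T' < T, ∃ M : ℝ, ∀ t ∈ Icc 0 T', ∀ x, ‖u t x‖ ≤ M) →
    IsTypeIBlowup u T → HasScaledContinuousAlignment ν T u →
    HasSmoothExtensionPast ν 0 u T

/-- **Theorem 1.1 ((CA) form) from its (CA′) form** (Giga–Miura 2011, Remark 1.4): the tree's
fact `gigaMiura_continuousAlignment_typeI` (`ContinuousAlignmentTypeI`) is the special case
`θ(t) = √(ν(T − t))` of `gigaMiura2011_scaledAlignment_typeI`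
(`hasScaledContinuousAlignment_of_continuousAlignment`). [cite: GigaMiura2011, Remark 1.4 (§1; HUPS preprint #956 p. 4)] -/
theorem gigaMiura_continuousAlignment_typeI_of_scaledAlignment
    (h : gigaMiura2011_scaledAlignment_typeI) : gigaMiura_continuousAlignment_typeI :=
  fun {_ν _T} hν hT {_u _p} hsol hLH hbdd hI hCA =>
    h hν hT hsol hLH hbdd hI (hasScaledContinuousAlignment_of_continuousAlignment hν hCA)

end Literature.Analysis.FluidPDE

end
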